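import Literature.Geometry.Kaehler.RiemannianHodgeRoughMetric
import HarnessLib

/-!
# `mem_harmonicForms_iff` is false as stated: the universal closure

Cone-insurance audit of the named fact `Literature.Geometry.Kaehler.mem_harmonicForms_iff`
(`Literature/Geometry/Kaehler/RiemannianHodge.lean`), which records Warner's "`Δ = δd + dδ` … is a
linear operator on `E^p(M)`" (GTM 94, 6.1, p. 220) and `H^p = {ω ∈ E^p(M) : Δω = 0}` (Def. 6.7,
p. 222) as "`α ∈ harmonicForms o h ↔ IsHarmonicForm o h α`" (the span of the harmonic forms is the
set of harmonic forms).

**Finding.** In Warner a Riemannian structure is a *smooth* choice of inner products (Ex. 1.23,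
p. 52), and `⋆` "takes smooth forms to smooth forms" (4.10 (6), p. 150). The Lean fact is a
`def … : Prop` declared in a section whose instance variables `[IsManifold I ∞ M]`,
`[IsContinuousRiemannianBundle E (TangentSpace I)]`, `[IsContMDiffRiemannianBundle I ∞ E (TangentSpace I)]`
are not mentioned in its body and hence are **not** among its binders:
`#check @mem_harmonicForms_iff` gives
`{E} [NormedAddCommGroup E] [NormedSpace ℝ E] {n} [Fact (finrank ℝ E = n)] {H} [TopologicalSpace H]
 {I} {M} [TopologicalSpace M] [ChartedSpace H M] [FiniteDimensional ℝ E]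
 [RiemannianBundle (TangentSpace I)] {k m} (o) → Prop`.
So the fact quantifies over fibrewise inner products of *no regularity* (and over charted spaces
that need not be smooth manifolds). In that generality it is false: `RiemannianHodgeRoughMetric.lean`
builds the rough metric `a dx² + a⁻¹ dy²` on `ℝ²` (`a = exp ∘ switch ∘ fst`, differentiable nowhere,
unit determinant so the volume form `dx ∧ dy` is smooth and the hypothesis `ho` holds) for which the
smooth functions `y + x²/2` and `-y` are junk-harmonic (`d⋆d` of each is the junk value `0`) while
their sum `x²/2` is not (`Δ(x²/2)(0) = -⋆(dx ∧ dy) ≠ 0`): `RoughMetric.not_mem_harmonicForms_iff`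
(the instance `k = 0`, `m = 2`) and `not_forall_mem_harmonicForms_iff` (closure over `M`, metric, `o`
at `E = H = ℝ × ℝ`).

This file only records the audit's certificate under the canonical name
`Literature.Geometry.Kaehler.not_mem_harmonicForms_iff`: the negation of the closure of the fact over
**exactly the binders it elaborates with** (types in `Type`), reduced in one line to
`not_forall_mem_harmonicForms_iff`. Nothing new is computed here.

**What is true.** Under the intended hypotheses (`[IsManifold I ∞ M]`,
`[IsContMDiffRiemannianBundle I ∞ E (TangentSpace I)]`; continuity of the metric is not needed) the
fact holds and is proved in the tree: `mem_harmonicForms_iff_of_contMDiffMetric`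
(`RiemannianHodgeSmoothProofs.lean`, via `mem_harmonicForms_iff_of_facts` of
`RiemannianHodgeHarmonic.lean`). The corrected *closed* named fact (binding those two instances in
the body, on the pattern of `isSmoothForm_mcoderiv_of_isContMDiffRiemannianBundle` in
`RiemannianHodgeCodiffSmoothFact.lean`) is left to the restating seat (D-0014: the original def is
not edited here).

## References

* F. W. Warner, *Foundations of Differentiable Manifolds and Lie Groups*, GTM 94 (1983): Ex. 1.23
  (p. 52), 4.10 (6) (p. 150), 6.1 (p. 220), Def. 6.7 (p. 222).
-/

noncomputable section

open scoped Manifold ContDiff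
open Bundle Module

namespace Literature.Geometry.Kaehler

/-- **The named fact `mem_harmonicForms_iff` is false as stated.** Closed universally over exactly
the binders it elaborates with — a normed space `E` with `finrank ℝ E = n`, a charted space `M`
over any model with corners `I` (no `IsManifold`), a fibrewise `RiemannianBundle` structure on the
tangent spaces (no continuity or smoothness in the base point), degrees `k + m = n` and an
orientation family `o` — the statement "`α ∈ harmonicForms o h ↔ IsHarmonicForm o h α` whenever the
volume form of `o` is smooth" fails. Witness: `E = H = M = ℝ × ℝ`, `I = 𝓘(ℝ, ℝ × ℝ)`, `n = 2`,
`k = 0`, `m = 2`, the rough metric `a dx² + a⁻¹ dy²` of `RoughMetric.roughBundle` with the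
standard orientation: `x²/2 = (y + x²/2) + (-y)` lies in the span of two junk-harmonic smooth
functions but `Δ(x²/2)(0) ≠ 0` (`RoughMetric.not_mem_harmonicForms_iff`,
`not_forall_mem_harmonicForms_iff`). The intended smooth-metric statement (Warner (1983), 6.1,
p. 220; Def. 6.7, p. 222; metric smooth by Ex. 1.23, p. 52) is the proved
`mem_harmonicForms_iff_of_contMDiffMetric`. [folklore] -/
theorem not_mem_harmonicForms_iff :
    ¬ ∀ {E : Type} [NormedAddCommGroup E] [NormedSpace ℝ E] {n : ℕ} [Fact (finrank ℝ E = n)]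
        {H : Type} [TopologicalSpace H] {I : ModelWithCorners ℝ E H}
        {M : Type} [TopologicalSpace M] [ChartedSpace H M] [FiniteDimensional ℝ E]
        [RiemannianBundle (fun x : M ↦ TangentSpace I x)] {k m : ℕ}
        (o : (x : M) → Orientation ℝ (TangentSpace I x) (Fin n)),
        mem_harmonicForms_iff (k := k) (m := m) o :=
  fun H ↦ not_forall_mem_harmonicForms_iff fun M _ _ _ o ↦
    @H (ℝ × ℝ) _ _ 2 RoughMetric.fact_finrank_real_prod (ℝ × ℝ) _ 𝓘(ℝ, ℝ × ℝ) M _ _ _ _ 0 2 o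

end Literature.Geometry.Kaehler
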